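import Mathlib
import Literature.Analysis.PDE.Wave1DEnergySeminorm

/-!
# Far half-share (stub `stub_farHalfShare`, crux `WindowedShellChannels`) — tail domination on a
# finite-dimensional family (linear algebra)

Abstract lemma: quadratic forms `T_R ≤ N` on `ℝ^ι` given by symmetric Gram matrices, with the
entries of `T_R` tending to `0`, satisfy `T_R ≤ ε N` for `R` large, uniformly on `ℝ^ι` — the
directions where `N` vanishes are harmless because `T_R ≤ N` forces `T_R` to vanish there too.
-/

set_option linter.dupNamespace false

namespace Summit.FinalStateConjecture.FinalStateConjecture.Theorems.WindowedShellChannelsSketch.FarHalfShare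

open Filter Topology

variable {ι : Type*} [Fintype ι]

/-- Expansion of the Gram quadratic form of `c + t • d` (symmetric matrix). -/
theorem gramForm_add_smul (G : ι → ι → ℝ) (hG : ∀ i j, G i j = G j i) (c d : ι → ℝ) (t : ℝ) :
    ∑ i, ∑ j, (c i + t * d i) * (c j + t * d j) * G i j
      = (∑ i, ∑ j, c i * c j * G i j) + 2 * t * (∑ i, ∑ j, c i * d j * G i j)
        + t ^ 2 * ∑ i, ∑ j, d i * d j * G i j := by
  have hswap : ∑ i, ∑ j, d i * c j * G i j = ∑ i, ∑ j, c i * d j * G i j := by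
    rw [Finset.sum_comm]
    exact Finset.sum_congr rfl fun i _ => Finset.sum_congr rfl fun j _ => by rw [hG j i]; ring
  have hexp : ∀ i j, (c i + t * d i) * (c j + t * d j) * G i j
      = c i * c j * G i j + t * (c i * d j * G i j) + t * (d i * c j * G i j)
        + t ^ 2 * (d i * d j * G i j) := fun i j => by ring
  simp only [hexp, Finset.sum_add_distrib, ← Finset.mul_sum]
  rw [hswap]; ring

/-- Cauchy–Schwarz consequence: a null vector of a nonnegative Gram form is in its radical. -/
theorem gramForm_null_orth (G : ι → ι → ℝ) (hG : ∀ i j, G i j = G j i)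
    (hG0 : ∀ c : ι → ℝ, 0 ≤ ∑ i, ∑ j, c i * c j * G i j) {k : ι → ℝ}
    (hk : ∑ i, ∑ j, k i * k j * G i j = 0) (d : ι → ℝ) :
    ∑ i, ∑ j, k i * d j * G i j = 0 := by
  set β : ℝ := ∑ i, ∑ j, k i * d j * G i j with hβ
  set ν : ℝ := ∑ i, ∑ j, d i * d j * G i j with hν
  have hν0 : 0 ≤ ν := hG0 d
  have key : ∀ t : ℝ, 0 ≤ 2 * t * β + t ^ 2 * ν := by
    intro t
    have h := hG0 (fun i => k i + t * d i)
    have h' := gramForm_add_smul G hG k d t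
    rw [h', hk, zero_add] at h
    exact h
  have hν1 : 0 < ν + 1 := by linarith
  have h1 := key (-β / (ν + 1))
  have h2 : 2 * (-β / (ν + 1)) * β + (-β / (ν + 1)) ^ 2 * ν
      = -(β ^ 2 * (ν + 2) / (ν + 1) ^ 2) := by
    field_simp
    ring
  rw [h2, neg_nonneg] at h1
  have h3 : β ^ 2 * (ν + 2) / (ν + 1) ^ 2 = 0 :=
    le_antisymm h1 (div_nonneg (mul_nonneg (sq_nonneg β) (by linarith)) (sq_nonneg _))
  have h4 : β ^ 2 * (ν + 2) = 0 := by
    rcases div_eq_zero_iff.1 h3 with h | h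
    · exact h
    · exact absurd h (pow_ne_zero 2 hν1.ne')
  have h5 : β ^ 2 = 0 := by
    rcases mul_eq_zero.1 h4 with h | h
    · exact h
    · exfalso; linarith
  exact pow_eq_zero_iff (two_ne_zero) |>.1 h5

/-- The Gram form of `k + w` equals that of `w` when `k` is a null vector. -/
theorem gramForm_null_add (G : ι → ι → ℝ) (hG : ∀ i j, G i j = G j i)
    (hG0 : ∀ c : ι → ℝ, 0 ≤ ∑ i, ∑ j, c i * c j * G i j) {k : ι → ℝ}
    (hk : ∑ i, ∑ j, k i * k j * G i j = 0) (w : ι → ℝ) :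
    ∑ i, ∑ j, (k i + w i) * (k j + w j) * G i j = ∑ i, ∑ j, w i * w j * G i j := by
  have h := gramForm_add_smul G hG k w 1
  simp only [one_mul, one_pow, mul_one] at h
  rw [h, hk, gramForm_null_orth G hG hG0 hk w]
  ring

/-- Homogeneity of a Gram form. -/
theorem gramForm_smul (G : ι → ι → ℝ) (a : ℝ) (c : ι → ℝ) :
    ∑ i, ∑ j, (a * c i) * (a * c j) * G i j = a ^ 2 * ∑ i, ∑ j, c i * c j * G i j := by
  rw [Finset.mul_sum]
  refine Finset.sum_congr rfl fun i _ => ?_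
  rw [Finset.mul_sum]
  exact Finset.sum_congr rfl fun j _ => by ring

/-- A Gram form is bounded by the `ℓ¹`-mass of its matrix times the sup norm squared. -/
theorem gramForm_le_norm_sq (G : ι → ι → ℝ) (c : ι → ℝ) :
    ∑ i, ∑ j, c i * c j * G i j ≤ ‖c‖ ^ 2 * ∑ i, ∑ j, |G i j| := by
  rw [Finset.mul_sum]
  refine Finset.sum_le_sum fun i _ => ?_
  rw [Finset.mul_sum]
  refine Finset.sum_le_sum fun j _ => ?_
  have hi : |c i| ≤ ‖c‖ := by rw [← Real.norm_eq_abs]; exact norm_le_pi_norm c i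
  have hj : |c j| ≤ ‖c‖ := by rw [← Real.norm_eq_abs]; exact norm_le_pi_norm c j
  calc c i * c j * G i j ≤ |c i * c j * G i j| := le_abs_self _
    _ = |c i| * |c j| * |G i j| := by rw [abs_mul, abs_mul]
    _ ≤ ‖c‖ * ‖c‖ * |G i j| := by gcongr
    _ = ‖c‖ ^ 2 * |G i j| := by ring

/-- Continuity of a Gram form in the vector. -/
theorem continuous_gramForm (G : ι → ι → ℝ) :
    Continuous fun c : ι → ℝ => ∑ i, ∑ j, c i * c j * G i j := by
  refine continuous_finsetSum _ fun i _ => continuous_finsetSum _ fun j _ => ?_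
  exact ((continuous_apply i).mul (continuous_apply j)).mul continuous_const

/-- **Tail domination on a finite-dimensional family.** Let `N(c) = Σ cᵢcⱼGᵢⱼ ≥ 0` and
`T_R(c) = Σ cᵢcⱼT_R,ᵢⱼ` with `0 ≤ T_R ≤ N` (symmetric matrices) and `T_R,ᵢⱼ → 0` as `R → ∞`.
Then for every `ε > 0`, eventually `T_R(c) ≤ ε N(c)` for ALL `c` simultaneously. -/
theorem gramForm_tail_domination (G : ι → ι → ℝ) (T : ℝ → ι → ι → ℝ)
    (hG : ∀ i j, G i j = G j i) (hT : ∀ R i j, T R i j = T R j i)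
    (hG0 : ∀ c : ι → ℝ, 0 ≤ ∑ i, ∑ j, c i * c j * G i j)
    (hT0 : ∀ R (c : ι → ℝ), 0 ≤ ∑ i, ∑ j, c i * c j * T R i j)
    (hTG : ∀ R (c : ι → ℝ), ∑ i, ∑ j, c i * c j * T R i j ≤ ∑ i, ∑ j, c i * c j * G i j)
    (hlim : ∀ i j, Tendsto (fun R => T R i j) atTop (𝓝 0)) {ε : ℝ} (hε : 0 < ε) :
    ∀ᶠ R in atTop, ∀ c : ι → ℝ,
      ∑ i, ∑ j, c i * c j * T R i j ≤ ε * ∑ i, ∑ j, c i * c j * G i j := by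
  classical
  -- the radical of `N`
  set N : (ι → ℝ) → ℝ := fun c => ∑ i, ∑ j, c i * c j * G i j with hN
  have hNsmul : ∀ (a : ℝ) (c : ι → ℝ), N (a • c) = a ^ 2 * N c := fun a c => by
    simp only [hN, Pi.smul_apply, smul_eq_mul]
    exact gramForm_smul G a c
  let K : Submodule ℝ (ι → ℝ) :=
    { carrier := {c | N c = 0}
      add_mem' := by
        intro c d hc hd
        simp only [Set.mem_setOf_eq] at hc hd ⊢
        show ∑ i, ∑ j, (c + d) i * (c + d) j * G i j = 0
        simp only [Pi.add_apply]
        rw [gramForm_null_add G hG hG0 hc d]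
        exact hd
      zero_mem' := by
        show ∑ i, ∑ j, (0 : ι → ℝ) i * (0 : ι → ℝ) j * G i j = 0
        simp
      smul_mem' := by
        intro a c hc
        simp only [Set.mem_setOf_eq] at hc ⊢
        rw [hNsmul, hc, mul_zero] }
  have hKmem : ∀ c, c ∈ K ↔ N c = 0 := fun c => Iff.rfl
  obtain ⟨W, hW⟩ := K.exists_isCompl
  -- `N` is positive definite on `W`
  have hWpos : ∀ w ∈ W, N w = 0 → w = 0 := by
    intro w hw hw0
    have h1 : w ∈ K ⊓ W := ⟨(hKmem w).2 hw0, hw⟩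
    rw [hW.disjoint.eq_bot] at h1
    exact (Submodule.mem_bot ℝ).1 h1
  -- the tail mass
  set S : ℝ → ℝ := fun R => ∑ i, ∑ j, |T R i j| with hS
  have hSlim : Tendsto S atTop (𝓝 0) := by
    have : Tendsto S atTop (𝓝 (∑ i : ι, ∑ j : ι, |(0 : ℝ)|)) := by
      refine tendsto_finsetSum _ fun i _ => tendsto_finsetSum _ fun j _ => ?_
      exact (continuous_abs.tendsto 0).comp (hlim i j)
    simpa using this
  -- reduction to `W`
  have hred : ∀ R, (∀ w ∈ W, ∑ i, ∑ j, w i * w j * T R i j ≤ ε * N w) →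
      ∀ c : ι → ℝ, ∑ i, ∑ j, c i * c j * T R i j ≤ ε * N c := by
    intro R hRW c
    have hc : c ∈ K ⊔ W := by rw [hW.sup_eq_top]; exact Submodule.mem_top
    obtain ⟨k, hk, w, hw, rfl⟩ := Submodule.mem_sup.1 hc
    have hk0 : N k = 0 := (hKmem k).1 hk
    have hkT : ∑ i, ∑ j, k i * k j * T R i j = 0 :=
      le_antisymm ((hTG R k).trans (le_of_eq hk0)) (hT0 R k)
    have e1 : ∑ i, ∑ j, (k + w) i * (k + w) j * T R i j = ∑ i, ∑ j, w i * w j * T R i j := by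
      simp only [Pi.add_apply]
      exact gramForm_null_add (T R) (hT R) (hT0 R) hkT w
    have e2 : N (k + w) = N w := by
      simp only [hN, Pi.add_apply]
      exact gramForm_null_add G hG hG0 hk0 w
    rw [e1, e2]
    exact hRW w hw
  -- the unit sphere of `W`
  by_cases hsph : (Metric.sphere (0 : W) 1).Nonempty
  · have hcomp : IsCompact (Metric.sphere (0 : W) 1) := isCompact_sphere _ _
    have hcont : ContinuousOn (fun w : W => N (w : ι → ℝ)) (Metric.sphere (0 : W) 1) :=
      ((continuous_gramForm G).comp continuous_subtype_val).continuousOn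
    obtain ⟨w₀, hw₀, hmin⟩ := hcomp.exists_isMinOn hsph hcont
    set m : ℝ := N (w₀ : ι → ℝ) with hm
    have hw₀ne : (w₀ : ι → ℝ) ≠ 0 := by
      intro h
      have : ‖w₀‖ = 1 := by simpa using hw₀
      rw [Submodule.coe_norm, h, norm_zero] at this
      exact zero_ne_one this
    have hm0 : 0 < m := by
      rcases (hG0 (w₀ : ι → ℝ)).lt_or_eq with h | h
      · exact h
      · exact absurd (hWpos _ w₀.2 h.symm) hw₀ne
    -- `N w ≥ m ‖w‖²` on `W`
    have hlow : ∀ w ∈ W, m * ‖w‖ ^ 2 ≤ N w := by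
      intro w hw
      by_cases hw0 : w = 0
      · rw [hw0, norm_zero]
        have : N 0 = 0 := by simp [hN]
        rw [this]; simp
      · have hnorm : 0 < ‖w‖ := norm_pos_iff.2 hw0
        set u : W := ⟨‖w‖⁻¹ • w, W.smul_mem _ hw⟩ with hu
        have hu1 : u ∈ Metric.sphere (0 : W) 1 := by
          rw [mem_sphere_zero_iff_norm, Submodule.coe_norm]
          show ‖‖w‖⁻¹ • w‖ = 1
          rw [norm_smul, norm_inv, norm_norm, inv_mul_cancel₀ hnorm.ne']
        have h1 : m ≤ N (u : ι → ℝ) := hmin hu1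
        have h2 : N (u : ι → ℝ) = ‖w‖⁻¹ ^ 2 * N w := by
          show N (‖w‖⁻¹ • w) = _
          exact hNsmul _ _
        rw [h2] at h1
        have h3 := mul_le_mul_of_nonneg_left h1 (sq_nonneg ‖w‖)
        calc m * ‖w‖ ^ 2 = ‖w‖ ^ 2 * m := by ring
          _ ≤ ‖w‖ ^ 2 * (‖w‖⁻¹ ^ 2 * N w) := h3
          _ = N w := by field_simp
    have hev : ∀ᶠ R in atTop, S R ≤ ε * m :=
      hSlim.eventually_le_const (mul_pos hε hm0)
    filter_upwards [hev] with R hR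
    refine hred R fun w hw => ?_
    calc ∑ i, ∑ j, w i * w j * T R i j ≤ ‖w‖ ^ 2 * S R := gramForm_le_norm_sq (T R) w
      _ ≤ ‖w‖ ^ 2 * (ε * m) := mul_le_mul_of_nonneg_left hR (sq_nonneg _)
      _ = ε * (m * ‖w‖ ^ 2) := by ring
      _ ≤ ε * N w := mul_le_mul_of_nonneg_left (hlow w hw) hε.le
  · -- `W` is trivial
    have hWbot : ∀ w ∈ W, w = 0 := by
      intro w hw
      by_contra hw0
      have hnorm : 0 < ‖w‖ := norm_pos_iff.2 hw0
      refine hsph ⟨⟨‖w‖⁻¹ • w, W.smul_mem _ hw⟩, ?_⟩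
      rw [mem_sphere_zero_iff_norm, Submodule.coe_norm]
      show ‖‖w‖⁻¹ • w‖ = 1
      rw [norm_smul, norm_inv, norm_norm, inv_mul_cancel₀ hnorm.ne']
    refine Eventually.of_forall fun R => hred R fun w hw => ?_
    rw [hWbot w hw]
    have h0 : N 0 = 0 := by simp [hN]
    rw [h0, mul_zero]
    simp

/-! ### The energy Gram matrix of a finite family of Cauchy data -/

section Energy

open MeasureTheory Set Literature.Analysis.Approximation

variable {V : ℝ → ℝ} {pos vel der : ι → ℝ → ℝ}

/-- The pointwise Gram expansion of the energy density of a finite linear combination of data. -/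
theorem energyDensity_comb_eq (V : ℝ → ℝ) (pos vel der : ι → ℝ → ℝ)
    (hder : ∀ i y, HasDerivAt (pos i) (der i y) y) (c : ι → ℝ) (y : ℝ) :
    (∑ i, c i * vel i y) ^ 2 + deriv (fun z => ∑ i, c i * pos i z) y ^ 2
        + V y * (∑ i, c i * pos i y) ^ 2
      = ∑ i, ∑ j, c i * c j *
          (vel i y * vel j y + der i y * der j y + V y * (pos i y * pos j y)) := by
  have hd : deriv (fun z => ∑ i, c i * pos i z) y = ∑ i, c i * der i y := by
    have := HasDerivAt.fun_sum (u := Finset.univ) (A := fun i z => c i * pos i z)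
      (A' := fun i => c i * der i y) (x := y) fun i _ => (hder i y).const_mul (c i)
    exact this.deriv
  rw [hd, sq, sq, sq, Finset.sum_mul_sum, Finset.sum_mul_sum, Finset.sum_mul_sum, Finset.mul_sum]
  simp only [Finset.mul_sum, ← Finset.sum_add_distrib]
  exact Finset.sum_congr rfl fun i _ => Finset.sum_congr rfl fun j _ => by ring

/-- **Tail domination for the energies of a finite-dimensional family of Cauchy data.** For finitely
many data pairs `(posᵢ, velᵢ)` (`posᵢ' = derᵢ`) of finite `V`-energy on `(ρ₁, ∞)` and every `ε > 0`,
for all large `R` the energy of EVERY linear combination on `(R, ∞)` is at most `ε` times its energy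
on `(ρ₁, ∞)`. -/
theorem energy_tail_domination (hV : Continuous V) (hV0 : ∀ y, 0 ≤ V y)
    (hpos : ∀ i, Continuous (pos i)) (hvel : ∀ i, Continuous (vel i))
    (hderc : ∀ i, Continuous (der i)) (hder : ∀ i y, HasDerivAt (pos i) (der i y) y) {ρ₁ : ℝ}
    (hIvel : ∀ i, IntegrableOn (fun y => vel i y ^ 2) (Ioi ρ₁))
    (hIder : ∀ i, IntegrableOn (fun y => der i y ^ 2) (Ioi ρ₁))
    (hIpos : ∀ i, IntegrableOn (fun y => V y * pos i y ^ 2) (Ioi ρ₁)) {ε : ℝ} (hε : 0 < ε) :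
    ∀ᶠ R in atTop, ρ₁ ≤ R ∧ ∀ c : ι → ℝ,
      IntegrableOn (fun y => (∑ i, c i * vel i y) ^ 2 + deriv (fun z => ∑ i, c i * pos i z) y ^ 2
        + V y * (∑ i, c i * pos i y) ^ 2) (Ioi ρ₁) ∧
      ∫ y in Ioi R, ((∑ i, c i * vel i y) ^ 2 + deriv (fun z => ∑ i, c i * pos i z) y ^ 2
        + V y * (∑ i, c i * pos i y) ^ 2)
      ≤ ε * ∫ y in Ioi ρ₁, ((∑ i, c i * vel i y) ^ 2 + deriv (fun z => ∑ i, c i * pos i z) y ^ 2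
        + V y * (∑ i, c i * pos i y) ^ 2) := by
  classical
  -- the Gram densities
  set m : ι → ι → ℝ → ℝ := fun i j y =>
    vel i y * vel j y + der i y * der j y + V y * (pos i y * pos j y) with hm
  have hmsymm : ∀ i j y, m i j y = m j i y := fun i j y => by simp only [hm]; ring
  have hVsq : ∀ i, Continuous fun y => Real.sqrt (V y) * pos i y := fun i =>
    (hV.sqrt).mul (hpos i)
  have hIpos' : ∀ i, IntegrableOn (fun y => (Real.sqrt (V y) * pos i y) ^ 2) (Ioi ρ₁) := by
    intro i
    refine (hIpos i).congr_fun (fun y _ => ?_) measurableSet_Ioi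
    rw [mul_pow, Real.sq_sqrt (hV0 y)]
  have hmint : ∀ i j, IntegrableOn (m i j) (Ioi ρ₁) := by
    intro i j
    have h1 := integrableOn_mul_of_sq (hvel i) (hvel j) (hIvel i) (hIvel j)
    have h2 := integrableOn_mul_of_sq (hderc i) (hderc j) (hIder i) (hIder j)
    have h3 := integrableOn_mul_of_sq (hVsq i) (hVsq j) (hIpos' i) (hIpos' j)
    refine ((h1.add h2).add h3).congr_fun (fun y _ => ?_) measurableSet_Ioi
    simp only [hm, Pi.add_apply]
    have : Real.sqrt (V y) * pos i y * (Real.sqrt (V y) * pos j y)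
        = (Real.sqrt (V y) * Real.sqrt (V y)) * (pos i y * pos j y) := by ring
    rw [this, Real.mul_self_sqrt (hV0 y)]
  -- the energy density of a combination
  set d : (ι → ℝ) → ℝ → ℝ := fun c y => (∑ i, c i * vel i y) ^ 2
    + deriv (fun z => ∑ i, c i * pos i z) y ^ 2 + V y * (∑ i, c i * pos i y) ^ 2 with hd
  have hdexp : ∀ c y, d c y = ∑ i, ∑ j, c i * c j * m i j y := fun c y =>
    energyDensity_comb_eq V pos vel der hder c y
  have hd0 : ∀ c y, 0 ≤ d c y := fun c y => by
    simp only [hd]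
    have := hV0 y
    positivity
  have hdint : ∀ c (S : ℝ), ρ₁ ≤ S → IntegrableOn (d c) (Ioi S) := by
    intro c S hS
    have : IntegrableOn (fun y => ∑ i, ∑ j, c i * c j * m i j y) (Ioi S) :=
      integrable_finsetSum _ fun i _ => integrable_finsetSum _ fun j _ =>
        ((hmint i j).mono_set (Ioi_subset_Ioi hS)).const_mul _
    exact this.congr_fun (fun y _ => (hdexp c y).symm) measurableSet_Ioi
  -- Gram matrices
  set Gm : ℝ → ι → ι → ℝ := fun S i j => ∫ y in Ioi S, m i j y with hGm
  have hGsymm : ∀ S i j, Gm S i j = Gm S j i := fun S i j => by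
    simp only [hGm]
    exact integral_congr_ae (Filter.Eventually.of_forall fun y => hmsymm i j y)
  have hform : ∀ c (S : ℝ), ρ₁ ≤ S →
      ∫ y in Ioi S, d c y = ∑ i, ∑ j, c i * c j * Gm S i j := by
    intro c S hS
    rw [integral_congr_ae (Filter.Eventually.of_forall fun y => hdexp c y)]
    rw [integral_finsetSum _ fun i _ => integrable_finsetSum _ fun j _ =>
      ((hmint i j).mono_set (Ioi_subset_Ioi hS)).const_mul _]
    refine Finset.sum_congr rfl fun i _ => ?_
    rw [integral_finsetSum _ fun j _ => ((hmint i j).mono_set (Ioi_subset_Ioi hS)).const_mul _]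
    refine Finset.sum_congr rfl fun j _ => ?_
    exact integral_const_mul _ _
  -- hypotheses of the abstract lemma
  set G : ι → ι → ℝ := Gm ρ₁ with hG
  set T : ℝ → ι → ι → ℝ := fun R => Gm (max R ρ₁) with hT
  have hmax : ∀ R : ℝ, ρ₁ ≤ max R ρ₁ := fun R => le_max_right _ _
  have hG0 : ∀ c : ι → ℝ, 0 ≤ ∑ i, ∑ j, c i * c j * G i j := fun c => by
    rw [hG, ← hform c ρ₁ le_rfl]
    exact setIntegral_nonneg measurableSet_Ioi fun y _ => hd0 c y
  have hT0 : ∀ R (c : ι → ℝ), 0 ≤ ∑ i, ∑ j, c i * c j * T R i j := fun R c => by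
    show 0 ≤ ∑ i, ∑ j, c i * c j * Gm (max R ρ₁) i j
    rw [← hform c _ (hmax R)]
    exact setIntegral_nonneg measurableSet_Ioi fun y _ => hd0 c y
  have hTG : ∀ R (c : ι → ℝ), ∑ i, ∑ j, c i * c j * T R i j ≤ ∑ i, ∑ j, c i * c j * G i j := by
    intro R c
    show ∑ i, ∑ j, c i * c j * Gm (max R ρ₁) i j ≤ ∑ i, ∑ j, c i * c j * Gm ρ₁ i j
    rw [← hform c _ (hmax R), ← hform c ρ₁ le_rfl]
    exact setIntegral_mono_set (hdint c ρ₁ le_rfl)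
      (ae_restrict_of_forall_mem measurableSet_Ioi fun y _ => hd0 c y)
      (Filter.Eventually.of_forall (Ioi_subset_Ioi (hmax R)))
  have hlim : ∀ i j, Tendsto (fun R => T R i j) atTop (𝓝 0) := by
    intro i j
    show Tendsto (fun R => ∫ y in Ioi (max R ρ₁), m i j y) atTop (𝓝 0)
    have hanti : Antitone fun R : ℝ => Ioi (max R ρ₁) := fun a b hab =>
      Ioi_subset_Ioi (max_le_max hab le_rfl)
    have h := tendsto_setIntegral_of_antitone (μ := volume) (f := m i j)
      (fun R => measurableSet_Ioi) hanti ⟨ρ₁, (hmint i j).mono_set (Ioi_subset_Ioi (hmax ρ₁))⟩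
    have hempty : (⋂ R : ℝ, Ioi (max R ρ₁)) = ∅ := by
      ext y
      simp only [mem_iInter, mem_Ioi, mem_empty_iff_false, iff_false, not_forall, not_lt]
      exact ⟨y, le_max_left _ _⟩
    rw [hempty, Measure.restrict_empty, integral_zero_measure] at h
    exact h
  have key := gramForm_tail_domination G T (hGsymm ρ₁) (fun R => hGsymm _) hG0 hT0 hTG hlim hε
  filter_upwards [key, eventually_ge_atTop ρ₁] with R hR hRρ
  refine ⟨hRρ, fun c => ⟨hdint c ρ₁ le_rfl, ?_⟩⟩
  have h1 := hR c
  have e1 : max R ρ₁ = R := max_eq_left hRρ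
  show ∫ y in Ioi R, d c y ≤ ε * ∫ y in Ioi ρ₁, d c y
  rw [hform c ρ₁ le_rfl, ← e1, hform c _ (hmax R)]
  exact h1


/-- **Registered sub-goal `stub_farHalfShare_tailDomination`** (stub `stub_farHalfShare`, crux
`WindowedShellChannels`): `energy_tail_domination` for the index type `Fin n₁ ⊕ Fin n₂` of the span of
the true kernel towers, all binders explicit. -/
theorem stub_farHalfShare_tailDomination : ∀ (n₁ n₂ : ℕ) (V : ℝ → ℝ) (pos vel der : Fin n₁ ⊕ Fin n₂ → ℝ → ℝ) (ρ₁ ε : ℝ), Continuous V → (∀ y, 0 ≤ V y) → (∀ i, Continuous (pos i)) → (∀ i, Continuous (vel i)) → (∀ i, Continuous (der i)) → (∀ i y, HasDerivAt (pos i) (der i y) y) → (∀ i, IntegrableOn (fun y => vel i y ^ 2) (Set.Ioi ρ₁)) → (∀ i, IntegrableOn (fun y => der i y ^ 2) (Set.Ioi ρ₁)) → (∀ i, IntegrableOn (fun y => V y * pos i y ^ 2) (Set.Ioi ρ₁)) → 0 < ε → ∀ᶠ R in Filter.atTop, ρ₁ ≤ R ∧ ∀ c : Fin n₁ ⊕ Fin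 n₂ → ℝ, IntegrableOn (fun y => (∑ i, c i * vel i y) ^ 2 + deriv (fun z => ∑ i, c i * pos i z) y ^ 2 + V y * (∑ i, c i * pos i y) ^ 2) (Set.Ioi ρ₁) ∧ ∫ y in Set.Ioi R, ((∑ i, c i * vel i y) ^ 2 + deriv (fun z => ∑ i, c i * pos i z) y ^ 2 + V y * (∑ i, c i * pos i y) ^ 2) ≤ ε * ∫ y in Set.Ioi ρ₁, ((∑ i, c i * vel i y) ^ 2 + deriv (fun z => ∑ i, c i * pos i z) y ^ 2 + V y * (∑ i, c i * pos i y) ^ 2) := by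
  intro n₁ n₂ V pos vel der ρ₁ ε hV hV0 hpos hvel hderc hder hIvel hIder hIpos hε
  exact energy_tail_domination hV hV0 hpos hvel hderc hder hIvel hIder hIpos hε

end Energy

end Summit.FinalStateConjecture.FinalStateConjecture.Theorems.WindowedShellChannelsSketch.FarHalfShare
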